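import Summits.ResolutionOfSingularities.ResolutionOfSingularities.Theorems.FrobeniusClosingSteerBetaHatStageWords
import Literature.AlgebraicGeometry.Resolution.StrictNormalCrossingsDescent
import HarnessLib

/-!
# Crux `Steer` (stmt-ResolutionOfSingularities-16345), chain W4.1 — K-β-glue-1: **a `y`-twisted monomial `x^a·y` is never a power of `x`**
# (hat-ring currency of the β-leaf; Theses-free, def-free)

OURS (campaign `res-hironaka`, rung L ★L-G4, slot W4.1; seat res-D-lib-2 g10 on res-L0-w41-plan-1 RULING 254(d), booking RULING 202(a)(3) / 251(h);
signatures VERBATIM from res-L0-w41-idea-1 `L/res-L0-w41-idea-1/g12/glue1_shape.lean` 68beaecaa9787c05; consumer = the `b = 1` branch of the β-leaf glue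
(III-X) `xLetterLawHat_of` (it excludes the `ShearLetterHat` / C′-at-0 branch, which needs `∃ a ≤ 1, u = x ^ a`, when the twist is `u = x^a·y`)).
Candidates, not facts; nothing here is a statement of H. Hironaka's manuscript [Hironaka2017] (status: under review). AI-written; AI review is
weaker than expert review.

* `twist_ne_pow_x` — in a hat ring `S` (`BetaPolygon.IsHatRing`: complete regular local of dimension four, perfect residue field) with
  `(x, y, z, w) = 𝔪`, `x ^ a * y ≠ x ^ n`: `S` is a regular local domain whose maximal ideal needs FOUR generators
  (`Res.mem_maximalIdeal_of_sum_mul_rsop_mem_sq`); `n ≤ a` would make `x^(a−n)·y = 1`, i.e. `y` (or `x`) a unit; `n > a` would give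
  `y = x·x^(n−a−1)`, a relation `(−x^(n−a−1))·x + 1·y + 0·z + 0·w = 0 ∈ 𝔪²` with a unit coefficient.
* `not_yfree_of_twist` — the form (III-X) consumes: from the stage datum (`BetaPolygon.IsArithStage`, whose first clause is the r.s.o.p.) and
  `u = x ^ a * y`, `¬ ∃ n, u = x ^ n` (idea-1's two-line proof, carried).
[cite: Matsumura1987, Thm. 14.2] [folklore]
-/

-- `Summit.<S>.<S>.…` duplicates the summit name by design (single-problem summit).
set_option linter.dupNamespace false

open IsLocalRing
open Summit.ResolutionOfSingularities.ResolutionOfSingularities.Theorems.SwitchingDichotomy.BetaPolygon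

namespace Summit.ResolutionOfSingularities.ResolutionOfSingularities.Theorems.SwitchingDichotomy.HatTwistNotPower

/-- **K-β-glue-1.** In a hat ring with r.s.o.p. `(x, y, z, w)`, the `y`-twisted monomial `x ^ a * y` is never a pure power of `x`.
[cite: Matsumura1987, Thm. 14.2] [folklore] -/
theorem twist_ne_pow_x (S : Type) [CommRing S] [IsLocalRing S] (x y z w : S) (hS : IsHatRing S)
    (hspan : Ideal.span {x, y, z, w} = maximalIdeal S) (a n : ℕ) : x ^ a * y ≠ x ^ n := by
  classical
  obtain ⟨-, hreg, -, hdim, -⟩ := hS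
  haveI := hreg
  haveI := Literature.AlgebraicGeometry.Resolution.isDomain_of_isRegularLocalRing S
  -- the r.s.o.p. as a `Fin 4`-family
  have hsfr : (maximalIdeal S).spanFinrank = 4 := by
    have h := IsRegularLocalRing.spanFinrank_maximalIdeal (R := S)
    rw [hdim] at h
    exact_mod_cast h
  set v : Fin 4 → S := ![x, y, z, w] with hv
  have hvspan : Ideal.span (Set.range v) = maximalIdeal S := by
    rw [← hspan, hv]
    congr 1
    ext s
    simp only [Set.mem_range, Set.mem_insert_iff, Set.mem_singleton_iff]
    constructor
    · rintro ⟨i, rfl⟩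
      fin_cases i <;> simp
    · rintro (rfl | rfl | rfl | rfl)
      · exact ⟨0, rfl⟩
      · exact ⟨1, rfl⟩
      · exact ⟨2, rfl⟩
      · exact ⟨3, rfl⟩
  have hxm : x ∈ maximalIdeal S := hspan ▸ Ideal.subset_span (by simp)
  have hym : y ∈ maximalIdeal S := hspan ▸ Ideal.subset_span (by simp)
  intro h
  rcases le_or_gt n a with hna | hna
  · -- `n ≤ a`: `x^(a−n) · y = 1`
    have hx0 : x ≠ 0 := by
      intro hx0
      -- `x = 0 ∈ 𝔪²` contradicts minimal generation: `1·x + 0·… = 0 ∈ 𝔪²` forces `1 ∈ 𝔪`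
      have hc := Literature.AlgebraicGeometry.Resolution.mem_maximalIdeal_of_sum_mul_rsop_mem_sq hsfr v hvspan
        (Pi.single 0 1) (by
          rw [Fin.sum_univ_four]
          simp [hv, hx0]) 0
      simp only [Pi.single_eq_same] at hc
      exact (maximalIdeal.isMaximal S).ne_top (Ideal.eq_top_of_isUnit_mem _ hc isUnit_one)
    have h1 : x ^ n * (x ^ (a - n) * y) = x ^ n * 1 := by
      rw [mul_one, ← mul_assoc, ← pow_add, Nat.add_sub_cancel' hna, h]
    have h2 : x ^ (a - n) * y = 1 := mul_left_cancel₀ (pow_ne_zero n hx0) h1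
    have hmem : x ^ (a - n) * y ∈ maximalIdeal S := Ideal.mul_mem_left _ _ hym
    rw [h2] at hmem
    exact (maximalIdeal.isMaximal S).ne_top (Ideal.eq_top_of_isUnit_mem _ hmem isUnit_one)
  · -- `a < n`: `y = x · x^(n−a−1)`, a relation with a unit coefficient on `y`
    have hx0 : x ^ a ≠ 0 := by
      intro hxa
      rw [hxa, zero_mul] at h
      -- then `x ^ n = 0`, so `x = 0`, and as above `1 ∈ 𝔪`
      have hx : x = 0 := pow_eq_zero_iff (n := n) (by omega) |>.mp h.symm
      have hc := Literature.AlgebraicGeometry.Resolution.mem_maximalIdeal_of_sum_mul_rsop_mem_sq hsfr v hvspan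
        (Pi.single 0 1) (by
          rw [Fin.sum_univ_four]
          simp [hv, hx]) 0
      simp only [Pi.single_eq_same] at hc
      exact (maximalIdeal.isMaximal S).ne_top (Ideal.eq_top_of_isUnit_mem _ hc isUnit_one)
    have hy : y = x * x ^ (n - a - 1) := by
      have h1 : x ^ a * y = x ^ a * (x * x ^ (n - a - 1)) := by
        rw [h, ← pow_succ', ← pow_add]
        congr 1
        omega
      exact mul_left_cancel₀ hx0 h1
    -- coefficients `(−x^(n−a−1), 1, 0, 0)` on `(x, y, z, w)`
    set c : Fin 4 → S := ![-x ^ (n - a - 1), 1, 0, 0] with hc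
    have hsum : ∑ i, c i * v i = 0 := by
      rw [Fin.sum_univ_four]
      simp [hc, hv, hy]
      ring
    have hc1 := Literature.AlgebraicGeometry.Resolution.mem_maximalIdeal_of_sum_mul_rsop_mem_sq hsfr v hvspan c
      (by rw [hsum]; exact zero_mem _) 1
    have : c 1 = 1 := by simp [hc]
    rw [this] at hc1
    exact (maximalIdeal.isMaximal S).ne_top (Ideal.eq_top_of_isUnit_mem _ hc1 isUnit_one)

/-- The form the `b = 1` branch of GLUE (III-X) `xLetterLawHat_of` consumes: from the stage datum's square-free clause with `b = 1`,
`¬ ∃ n, u = x ^ n` (so the `ShearLetterHat` / C′-at-0 branch, which needs `∃ a ≤ 1, u = x ^ a`, is correctly excluded and the residual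
`XLetterLawYEscHat` slot is the one that applies). (res-L0-w41-idea-1, carried.) [folklore] -/
theorem not_yfree_of_twist (S : Type) [CommRing S] [IsLocalRing S] (x y z w u f : S) (d : ℕ) (hS : IsHatRing S)
    (hst : IsArithStage S x y z w u f d) (a : ℕ) (hu : u = x ^ a * y) : ¬ ∃ n : ℕ, u = x ^ n := by
  rintro ⟨n, hn⟩
  exact twist_ne_pow_x S x y z w hS hst.1 a n (hu ▸ hn ▸ rfl)

end Summit.ResolutionOfSingularities.ResolutionOfSingularities.Theorems.SwitchingDichotomy.HatTwistNotPower
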